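import Literature.NumberTheory.Automorphic.ArchRankOneJumpAllOrders           -- ★ FILE 4c (this seat, p850955): the junction in quotient currency; brings FILE 3 ∕ 4a ∕ 4b, ★ (A0)∕(A0-b)∕(A0-c)
import Literature.MeasureTheory.Group.InvariantQuotientMeasure                     -- ★ `exists_smulInvariantMeasure_quotient` (an invariant Radon measure on `U(J) ⧸ T` exists)
import HarnessLib

/-!
# (A0-CASIMIR-∞) FILE 4d — THE JUNCTION IN `K × N` CHART CURRENCY: `∂_ψⁿ F_f(0⁺) − ∂_ψⁿ F_f(0⁻) = κ₀ · iⁿ · ∂_xⁿ Λ_f(0)` with `Λ_f` the half-chart integral of ★ p850603 ∕ FILE 3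
# (the shape SPEC-I3 v1.1 (B-r1) consumes: `HasOneSidedJump (fun ψ => iteratedDeriv n (F f) ψ) (κ₀ * I ^ n * iteratedDeriv n (Λ f) 0)`; Shelstad 1979 Prop. 4.5; Bouaziz 1994 (I₃))

Topic `NumberTheory/Automorphic`; namespace `Literature.NumberTheory.Automorphic.UnitaryGroup`.  THEOREMS ONLY (no `def`, no instance, no notation, no axiom, no named fact, no
`sorry`).  Cell `pub/hodgecm-mathlib`, crux H413 (`stmt-HodgeConjecture-24833`), line LH3 (closer stub `stub_N9`, direct road), letter L1 clause (I₃), brick **(B-r1)** of F0P3a-p08 (g23)'s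
SPEC-I3 v1.1 (`F0/P3a/F0P3a-p08/g23/SPEC-I3-jumps.v1.1.md` ef5032a97564600e) = (A0-CASIMIR-∞) FILE 4 (F0P3a-p09 (g6)); this file re-reads ★ FILE 4c's head (quotient functional `G` on
`U(J) ⧸ T`) in the `K × N` chart currency that (B-desc-hyp)∕(B-norm)∕(B-trans) spell (`Λ f`, ★ p850603's token shape), with the ELLIPTIC family written with complex multiplication
`(2 sin ψ : ℂ) * ∫ …` (★ p850353 ∕ (B-desc)'s binder of record) instead of `•`.

THE MATHEMATICS.  `K ≤ U(J)` compact with `U(J) = K · B` (`hKB`), `κ`, `μ_N` Haar; `Λ_f(x) = ∫_{K×N} f(k (t_{0,θ} h_{x∕2} n h_{x∕2}) k⁻¹) d(κ ⊗ μ_N)`.  Pick ANY invariant Radon `μ ≠ 0` on `U(J) ⧸ T`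
(★ `exists_smulInvariantMeasure_quotient`: `U(J)` unimodular, the Haar measure of the abelian `T` inversion invariant); then `μ = C • ((k,n) ↦ knT)_*(κ ⊗ μ_N)`, `C > 0`
(★ `exists_measure_quotient_torusU_complex_two_eq_smul_map`) and `G := C • Λ_f` is a continuous (indeed `C^∞`, ★ FILE 3) function agreeing with `|eˣ − e⁻ˣ| • Φ^T_μ(t_{x,θ}, f)` off `0`
(★ (A0-b) `abs_sub_smul_integral_descConj_hypBlockGL_eq_smul_integral_prod`).  ★ FILE 4c gives `HasOneSidedJump (∂_ψⁿ F_f) ((C₁∕C₂) · iⁿ · ∂_xⁿ G(0))`, and `∂_xⁿ G(0) = C • ∂_xⁿ Λ_f(0)`: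
  **`HasOneSidedJump (ψ ↦ ∂_ψⁿ F_f ψ) (κ₀ · iⁿ · ∂_xⁿ Λ_f(0))`, `κ₀ = C₁ C ∕ C₂ > 0`, ONE constant for all `n`, `f`, `θ`** (order `0` included: «the same constant as order 0»).

WHAT IS PROVED.  **`exists_hasOneSidedJump_iteratedDeriv_allOrders_chart_of_eq_over`** (statement below; `F`, `Λ` are bound families with their defining hypotheses `hF`, `hΛ`).
HONEST LABEL: HC_CM is proved only modulo the 7 printed citations (2 remaining: hLiu418 = `stmt-HodgeConjecture-24832`, h413 = `stmt-HodgeConjecture-24833`) until rung 0 closes;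
count-neutral currency bridge, pays nothing by itself.

## References
* [Shelstad1979] D. Shelstad, *Characters and inner forms of a quasi-split group over ℝ*, Compositio Math. 39 (1979), Lemma 4.3 p. 25, Prop. 4.5 p. 26.
* [Bouaziz1994IntegralesOrbitales] A. Bouaziz, *Intégrales orbitales sur les groupes de Lie réductifs*, Ann. Sci. ÉNS 27 (1994), §3.2 (I₃) p. 580.
* [Varadarajan1989] V. S. Varadarajan, *An Introduction to Harmonic Analysis on Semisimple Lie Groups*, Cambridge Stud. Adv. Math. 16 (1989), §6.4 Thms 23–24.
* [Rogawski1990] J. D. Rogawski, *Automorphic Representations of Unitary Groups in Three Variables*, Ann. of Math. Stud. 123 (1990), §8.2 pp. 119–123.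
-/

set_option autoImplicit false

noncomputable section

open MeasureTheory Measure Set Filter Topology Complex NumberField NumberField.InfinitePlace
open scoped ENNReal NNReal ComplexConjugate ContDiff Matrix.Norms.Operator MatrixGroups Real

namespace Literature.NumberTheory.Automorphic

open Literature.MeasureTheory.Group Literature.NumberTheory.Automorphic.Shelstad1979.StableOrbitalIntegrals

namespace UnitaryGroup

open Literature.NumberTheory.Rogawski1990
open Literature.NumberTheory.Automorphic.UnitaryGroup.HeisRing Literature.NumberTheory.Automorphic.UnitaryGroup.LineRing

variable (L : Type) [Field L] [NumberField L] (w : {w : InfinitePlace L // IsComplex w})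
  {J : Matrix (Fin 2) (Fin 2) ℂ} (hJ : J = (StdForm.antidiagonal 2).over ℂ) [Fact (0 < 2 * π)]
  [MeasurableSpace ↥(unitaryGroupOfForm (starRingEnd ℂ) J)] [BorelSpace ↥(unitaryGroupOfForm (starRingEnd ℂ) J)]
  (ν : Measure ↥(unitaryGroupOfForm (starRingEnd ℂ) J)) [ν.IsHaarMeasure] [ν.IsMulRightInvariant]
  {K : Subgroup ↥(unitaryGroupOfForm (starRingEnd ℂ) J)} (κ : Measure ↥K) (μN : Measure ↥(unipotentU (starRingEnd ℂ) J))

include L w hJ in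
/-- **THE ALL-ORDERS RANK-ONE JUMP RELATION IN `K × N` CHART CURRENCY (SPEC-I3 (B-r1)).**  `ν` a two-sided Haar measure on `U(J)`, `K ≤ U(J)` compact with `U(J) = K·B`, `κ`, `μ_N` Haar,
`Ω_J` the split-frame Casimir (`hΩJ`).  There is ONE `κ₀ > 0` such that for every `f ∈ C_c^∞(M₂(ℂ), ℂ)`, every `θ`, the elliptic family `F` bound by
`hF : F g ψ = (2 sin ψ : ℂ) * ∫_{U(J)} g(↑↑(h · P t_{e^{iθ}}(ψ) P⁻¹ · h⁻¹)) dν` (★ p850353's torus token, complex multiplication), the split family `Λ` bound by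
`hΛ : Λ g x = ∫_{K×N} g(↑↑(k (t_{0,θ} h_{x∕2} n h_{x∕2}) k⁻¹)) d(κ ⊗ μ_N)` (★ p850603's token) and EVERY `n`:
**`HasOneSidedJump (fun ψ => iteratedDeriv n (F f) ψ) (κ₀ * I ^ n * iteratedDeriv n (Λ f) 0)`** (`κ₀ = C₁·C∕C₂`: ★ FILE 4c's `C₁∕C₂` for an auxiliary invariant `μ` on `U(J) ⧸ T` times the
Iwasawa constant `C` of `μ` w.r.t. `(κ, μ_N)`). [cite: Shelstad1979, Prop. 4.5 p. 26] [cite: Bouaziz1994IntegralesOrbitales, §3.2 (I₃) p. 580] [cite: Varadarajan1989, §6.4 Thm 24] -/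
theorem exists_hasOneSidedJump_iteratedDeriv_allOrders_chart_of_eq_over
    (hK : IsCompact (K : Set ↥(unitaryGroupOfForm (starRingEnd ℂ) J))) (hKB : ∀ g : ↥(unitaryGroupOfForm (starRingEnd ℂ) J), ∃ k ∈ K, ∃ b ∈ borelU (starRingEnd ℂ) J, g = k * b)
    [IsHaarMeasure κ] [IsHaarMeasure μN] (ΩJ : (Matrix (Fin 2) (Fin 2) ℂ → ℂ) → Matrix (Fin 2) (Fin 2) ℂ → ℂ)
    (hΩJ : ∀ (g : Matrix (Fin 2) (Fin 2) ℂ → ℂ) (Y : Matrix (Fin 2) (Fin 2) ℂ), ΩJ g Y =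
      -(fderiv ℝ (fderiv ℝ g) Y (Y * !![0, I; I, 0]) (Y * !![0, I; I, 0]) + fderiv ℝ g Y (Y * !![0, I; I, 0] * !![0, I; I, 0])) +
        (fderiv ℝ (fderiv ℝ g) Y (Y * !![1, 0; 0, -1]) (Y * !![1, 0; 0, -1]) + fderiv ℝ g Y (Y * !![1, 0; 0, -1] * !![1, 0; 0, -1])) +
        (fderiv ℝ (fderiv ℝ g) Y (Y * !![0, I; -I, 0]) (Y * !![0, I; -I, 0]) + fderiv ℝ g Y (Y * !![0, I; -I, 0] * !![0, I; -I, 0]))) :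
    ∃ κ₀ : ℝ, 0 < κ₀ ∧ ∀ (f : Matrix (Fin 2) (Fin 2) ℂ → ℂ), ContDiff ℝ ∞ f → HasCompactSupport f → ∀ (θ : ℝ) (F : (Matrix (Fin 2) (Fin 2) ℂ → ℂ) → ℝ → ℂ),
      (∀ (g : Matrix (Fin 2) (Fin 2) ℂ → ℂ) (ψ : ℝ), F g ψ = (2 * Real.sin ψ : ℂ) *
        ∫ h : ↥(unitaryGroupOfForm (starRingEnd ℂ) J), g (((h * (⟨(Matrix.GeneralLinearGroup.mkOfDetNeZero !![(1 : ℂ), 1; 1, -1] det_cayleyTwo_ne_zero) * circleDiagonal 2 ![Circle.exp θ * Circle.exp ψ, Circle.exp θ * Circle.exp (-ψ)] * ((Matrix.GeneralLinearGroup.mkOfDetNeZero !![(1 : ℂ), 1; 1, -1] det_cayleyTwo_ne_zero))⁻¹,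
            cayley_conj_circleDiagonal_mem_of_eq_over hJ _⟩ : ↥(unitaryGroupOfForm (starRingEnd ℂ) J)) * h⁻¹ : ↥(unitaryGroupOfForm (starRingEnd ℂ) J)) : GL (Fin 2) ℂ) : Matrix (Fin 2) (Fin 2) ℂ) ∂ν) →
      ∀ (Λ : (Matrix (Fin 2) (Fin 2) ℂ → ℂ) → ℝ → ℂ), (∀ (g : Matrix (Fin 2) (Fin 2) ℂ → ℂ) (x : ℝ), Λ g x = ∫ p : ↥K × ↥(unipotentU (starRingEnd ℂ) J), g ((((((p.1 : ↥K) : ↥(unitaryGroupOfForm (starRingEnd ℂ) J)) * (((⟨hypBlockGL 0 θ, hypBlockGL_mem_of_eq_over hJ 0 θ⟩ : ↥(unitaryGroupOfForm (starRingEnd ℂ) J))) * ((⟨hypBlockGL (x / 2) 0, hypBlockGL_mem_of_eq_over hJ (x / 2) 0⟩ : ↥(unitaryGroupOfForm (starRingEnd ℂ) J))) * ((p.2 : ↥(unipotentU (starRingEnd ℂ) J)) : ↥(unitaryGroupOfForm (starRingEnd ℂ) J)) * ((⟨hypBlockGL (x / 2) 0, hypBlockGL_mem_of_eq_over hJ (x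 / 2) 0⟩ : ↥(unitaryGroupOfForm (starRingEnd ℂ) J)))) * ((p.1 : ↥K) : ↥(unitaryGroupOfForm (starRingEnd ℂ) J))⁻¹ : ↥(unitaryGroupOfForm (starRingEnd ℂ) J))) : GL (Fin 2) ℂ) : Matrix (Fin 2) (Fin 2) ℂ) ∂(κ.prod μN)) →
      ∀ n : ℕ, HasOneSidedJump (fun ψ : ℝ => iteratedDeriv n (F f) ψ) ((κ₀ : ℂ) * Complex.I ^ n * iteratedDeriv n (Λ f) 0) := by
  haveI : LocallyCompactSpace ↥(unitaryGroupOfForm (starRingEnd ℂ) J) := locallyCompactSpace_unitaryGroupOfForm_complex J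
  haveI : SecondCountableTopology ↥(unitaryGroupOfForm (starRingEnd ℂ) J) := secondCountableTopology_unitaryGroupOfForm_complex J
  have hT : IsClosed (torusU (starRingEnd ℂ) J : Set ↥(unitaryGroupOfForm (starRingEnd ℂ) J)) := isClosed_torusU_two _ _
  haveI : LocallyCompactSpace ↥(torusU (starRingEnd ℂ) J) := hT.isClosedEmbedding_subtypeVal.locallyCompactSpace
  haveI : SecondCountableTopology ↥(torusU (starRingEnd ℂ) J) := TopologicalSpace.Subtype.secondCountableTopology _
  haveI : BorelSpace ↥(torusU (starRingEnd ℂ) J) := Subtype.borelSpace _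
  letI : MeasurableSpace (↥(unitaryGroupOfForm (starRingEnd ℂ) J) ⧸ torusU (starRingEnd ℂ) J) := borel _
  haveI : BorelSpace (↥(unitaryGroupOfForm (starRingEnd ℂ) J) ⧸ torusU (starRingEnd ℂ) J) := ⟨rfl⟩
  -- an invariant Radon measure `μ ≠ 0` on `U(J) ⧸ T` and its Iwasawa form w.r.t. `(κ, μ_N)`
  have hTinv : ∀ t : Measure ↥(torusU (starRingEnd ℂ) J), t.IsHaarMeasure → t.IsInvInvariant := fun t ht => by
    haveI := ht
    haveI : t.IsMulRightInvariant := isMulRightInvariant_of_torusU t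
    exact isInvInvariant_of_isMulRightInvariant t
  obtain ⟨μ, hμinv, hμfin, hμpos⟩ := WeilQuotient.exists_smulInvariantMeasure_quotient (H := torusU (starRingEnd ℂ) J) hT hTinv ν
  haveI := hμinv
  haveI := hμfin
  haveI := hμpos
  have hμ : μ ≠ 0 := fun h => by
    have h1 := IsOpenPosMeasure.open_pos (μ := μ) Set.univ isOpen_univ Set.univ_nonempty
    rw [h] at h1
    exact h1 rfl
  set α : Measure ↥(torusU (starRingEnd ℂ) J) := Measure.haar with hα
  obtain ⟨C, hC0, hμC⟩ := exists_measure_quotient_torusU_complex_two_eq_smul_map hJ hK hKB κ α μN μ hμ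
  have hCpos : (0 : ℝ) < (C : ℝ) := NNReal.coe_pos.2 (pos_iff_ne_zero.2 hC0)
  haveI : CompactSpace ↥K := isCompact_iff_compactSpace.1 hK
  obtain ⟨C₁, C₂, hC₁, hC₂, -, -, hall⟩ := exists_hasOneSidedJump_iteratedDeriv_allOrders_of_eq_over L w hJ ν μ hμ ΩJ hΩJ
  refine ⟨C₁ / C₂ * C, by positivity, fun f hf hfc θ F hF Λ hΛ n => ?_⟩
  -- the `•`-form of the elliptic family
  obtain ⟨F', hF'⟩ : ∃ F' : (Matrix (Fin 2) (Fin 2) ℂ → ℂ) → ℝ → ℂ, ∀ (g : Matrix (Fin 2) (Fin 2) ℂ → ℂ) (ψ : ℝ), F' g ψ = (2 * Real.sin ψ) •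
      ∫ h : ↥(unitaryGroupOfForm (starRingEnd ℂ) J), g (((h * (⟨(Matrix.GeneralLinearGroup.mkOfDetNeZero !![(1 : ℂ), 1; 1, -1] det_cayleyTwo_ne_zero) * circleDiagonal 2 ![Circle.exp θ * Circle.exp ψ, Circle.exp θ * Circle.exp (-ψ)] * ((Matrix.GeneralLinearGroup.mkOfDetNeZero !![(1 : ℂ), 1; 1, -1] det_cayleyTwo_ne_zero))⁻¹,
            cayley_conj_circleDiagonal_mem_of_eq_over hJ _⟩ : ↥(unitaryGroupOfForm (starRingEnd ℂ) J)) * h⁻¹ : ↥(unitaryGroupOfForm (starRingEnd ℂ) J)) : GL (Fin 2) ℂ) : Matrix (Fin 2) (Fin 2) ℂ) ∂ν := ⟨fun g ψ => _, fun _ _ => rfl⟩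
  have hFF' : F f = F' f := funext fun ψ => by
    rw [hF, hF', Complex.real_smul]
    push_cast
    ring
  -- `G := C • Λ f` agrees with the normalised quotient integral off `0` (★ (A0-b)) and is continuous (★ FILE 3)
  have hΛs : ContDiff ℝ ∞ (Λ f) := (iteratedDeriv_integral_prod_conj_hypBlockGL_half hJ κ μN hK ΩJ hΩJ θ Λ hΛ hf hfc 0).1
  have hFc : Continuous fun g : ↥(unitaryGroupOfForm (starRingEnd ℂ) J) => f ((g : GL (Fin 2) ℂ) : Matrix (Fin 2) (Fin 2) ℂ) := hf.continuous.comp (Units.continuous_val.comp continuous_subtype_val)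
  have hG : ∀ x : ℝ, x ≠ 0 → (fun x => (C : ℝ) • Λ f x) x = |Real.exp x - Real.exp (-x)| •
      ∫ y, descConj (⟨hypBlockGL x θ, hypBlockGL_mem_of_eq_over hJ x θ⟩ : ↥(unitaryGroupOfForm (starRingEnd ℂ) J)) (torusU (starRingEnd ℂ) J) (LineRing.forall_mem_torusU_comm (starRingEnd ℂ) J (hypBlockGL_mem_torusU hJ x θ)) (fun g : ↥(unitaryGroupOfForm (starRingEnd ℂ) J) => f ((g : GL (Fin 2) ℂ) : Matrix (Fin 2) (Fin 2) ℂ)) y ∂μ := fun x hx => by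
    show (C : ℝ) • Λ f x = _
    rw [hΛ]
    exact (abs_sub_smul_integral_descConj_hypBlockGL_eq_smul_integral_prod hJ κ μN μ hμC (fun g : ↥(unitaryGroupOfForm (starRingEnd ℂ) J) => f ((g : GL (Fin 2) ℂ) : Matrix (Fin 2) (Fin 2) ℂ)) hFc θ hx).symm
  have hG0 : ContinuousAt (fun x => (C : ℝ) • Λ f x) 0 := (hΛs.continuous.const_smul (C : ℝ)).continuousAt
  have hj := hall f hf hfc θ F' hF' (fun x => (C : ℝ) • Λ f x) hG0 hG n
  rw [← hFF', iteratedDeriv_fun_const_smul_field] at hj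
  have e : (((C₁ / C₂ : ℝ)) : ℂ) * Complex.I ^ n * ((C : ℝ) • iteratedDeriv n (Λ f) 0) =
      (((C₁ / C₂ * C : ℝ)) : ℂ) * Complex.I ^ n * iteratedDeriv n (Λ f) 0 := by
    rw [Complex.real_smul]
    push_cast
    ring
  rw [e] at hj
  exact hj

/-! ## ED. 2: the same head with the torus point written in WALL-NORMAL ANGLES `(θ + ψ, θ − ψ)` (the token of ★ (B-desc) box edition p851016 ∕ `hcNrm = e_i − e_j`) -/

include L w hJ in
/-- **(B-r1), ANGLE FORM.**  Identical to `exists_hasOneSidedJump_iteratedDeriv_allOrders_chart_of_eq_over` but with the Cayley torus point spelled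
`P · circleDiagonal 2 ![Circle.exp (θ + ψ), Circle.exp (θ − ψ)] · P⁻¹` — the reading of ★ (B-desc)'s `![Circle.exp (c w₀ 0), Circle.exp (c w₀ 2)]` along the normal ray
`c = p + ψ • hcNrm w₀ 0 2` at a wall point with `p w₀ 0 = p w₀ 2 = θ` (`Circle.exp (θ ± ψ) = Circle.exp θ · Circle.exp (±ψ)`). [cite: Shelstad1979, Prop. 4.5 p. 26]
[cite: Bouaziz1994IntegralesOrbitales, §3.2 (I₃) p. 580] -/
theorem exists_hasOneSidedJump_iteratedDeriv_allOrders_chart_angles_of_eq_over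
    (hK : IsCompact (K : Set ↥(unitaryGroupOfForm (starRingEnd ℂ) J))) (hKB : ∀ g : ↥(unitaryGroupOfForm (starRingEnd ℂ) J), ∃ k ∈ K, ∃ b ∈ borelU (starRingEnd ℂ) J, g = k * b)
    [IsHaarMeasure κ] [IsHaarMeasure μN] (ΩJ : (Matrix (Fin 2) (Fin 2) ℂ → ℂ) → Matrix (Fin 2) (Fin 2) ℂ → ℂ)
    (hΩJ : ∀ (g : Matrix (Fin 2) (Fin 2) ℂ → ℂ) (Y : Matrix (Fin 2) (Fin 2) ℂ), ΩJ g Y =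
      -(fderiv ℝ (fderiv ℝ g) Y (Y * !![0, I; I, 0]) (Y * !![0, I; I, 0]) + fderiv ℝ g Y (Y * !![0, I; I, 0] * !![0, I; I, 0])) +
        (fderiv ℝ (fderiv ℝ g) Y (Y * !![1, 0; 0, -1]) (Y * !![1, 0; 0, -1]) + fderiv ℝ g Y (Y * !![1, 0; 0, -1] * !![1, 0; 0, -1])) +
        (fderiv ℝ (fderiv ℝ g) Y (Y * !![0, I; -I, 0]) (Y * !![0, I; -I, 0]) + fderiv ℝ g Y (Y * !![0, I; -I, 0] * !![0, I; -I, 0]))) :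
    ∃ κ₀ : ℝ, 0 < κ₀ ∧ ∀ (f : Matrix (Fin 2) (Fin 2) ℂ → ℂ), ContDiff ℝ ∞ f → HasCompactSupport f → ∀ (θ : ℝ) (F : (Matrix (Fin 2) (Fin 2) ℂ → ℂ) → ℝ → ℂ),
      (∀ (g : Matrix (Fin 2) (Fin 2) ℂ → ℂ) (ψ : ℝ), F g ψ = (2 * Real.sin ψ : ℂ) *
        ∫ h : ↥(unitaryGroupOfForm (starRingEnd ℂ) J), g (((h * (⟨(Matrix.GeneralLinearGroup.mkOfDetNeZero !![(1 : ℂ), 1; 1, -1] det_cayleyTwo_ne_zero) * circleDiagonal 2 ![Circle.exp (θ + ψ), Circle.exp (θ - ψ)] * ((Matrix.GeneralLinearGroup.mkOfDetNeZero !![(1 : ℂ), 1; 1, -1] det_cayleyTwo_ne_zero))⁻¹,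
            cayley_conj_circleDiagonal_mem_of_eq_over hJ _⟩ : ↥(unitaryGroupOfForm (starRingEnd ℂ) J)) * h⁻¹ : ↥(unitaryGroupOfForm (starRingEnd ℂ) J)) : GL (Fin 2) ℂ) : Matrix (Fin 2) (Fin 2) ℂ) ∂ν) →
      ∀ (Λ : (Matrix (Fin 2) (Fin 2) ℂ → ℂ) → ℝ → ℂ), (∀ (g : Matrix (Fin 2) (Fin 2) ℂ → ℂ) (x : ℝ), Λ g x = ∫ p : ↥K × ↥(unipotentU (starRingEnd ℂ) J), g ((((((p.1 : ↥K) : ↥(unitaryGroupOfForm (starRingEnd ℂ) J)) * (((⟨hypBlockGL 0 θ, hypBlockGL_mem_of_eq_over hJ 0 θ⟩ : ↥(unitaryGroupOfForm (starRingEnd ℂ) J))) * ((⟨hypBlockGL (x / 2) 0, hypBlockGL_mem_of_eq_over hJ (x / 2) 0⟩ : ↥(unitaryGroupOfForm (starRingEnd ℂ) J))) * ((p.2 : ↥(unipotentU (starRingEnd ℂ) J)) : ↥(unitaryGroupOfForm (starRingEnd ℂ) J)) * ((⟨hypBlockGL (x / 2) 0, hypBlockGL_mem_of_eq_over hJ (x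 / 2) 0⟩ : ↥(unitaryGroupOfForm (starRingEnd ℂ) J)))) * ((p.1 : ↥K) : ↥(unitaryGroupOfForm (starRingEnd ℂ) J))⁻¹ : ↥(unitaryGroupOfForm (starRingEnd ℂ) J))) : GL (Fin 2) ℂ) : Matrix (Fin 2) (Fin 2) ℂ) ∂(κ.prod μN)) →
      ∀ n : ℕ, HasOneSidedJump (fun ψ : ℝ => iteratedDeriv n (F f) ψ) ((κ₀ : ℂ) * Complex.I ^ n * iteratedDeriv n (Λ f) 0) := by
  obtain ⟨κ₀, hκ₀, h⟩ := exists_hasOneSidedJump_iteratedDeriv_allOrders_chart_of_eq_over L w hJ ν κ μN hK hKB ΩJ hΩJ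
  refine ⟨κ₀, hκ₀, fun f hf hfc θ F hF Λ hΛ n => h f hf hfc θ F (fun g ψ => ?_) Λ hΛ n⟩
  have hpt : (⟨(Matrix.GeneralLinearGroup.mkOfDetNeZero !![(1 : ℂ), 1; 1, -1] det_cayleyTwo_ne_zero) * circleDiagonal 2 ![Circle.exp (θ + ψ), Circle.exp (θ - ψ)] * ((Matrix.GeneralLinearGroup.mkOfDetNeZero !![(1 : ℂ), 1; 1, -1] det_cayleyTwo_ne_zero))⁻¹,
            cayley_conj_circleDiagonal_mem_of_eq_over hJ _⟩ : ↥(unitaryGroupOfForm (starRingEnd ℂ) J)) =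
      (⟨(Matrix.GeneralLinearGroup.mkOfDetNeZero !![(1 : ℂ), 1; 1, -1] det_cayleyTwo_ne_zero) * circleDiagonal 2 ![Circle.exp θ * Circle.exp ψ, Circle.exp θ * Circle.exp (-ψ)] * ((Matrix.GeneralLinearGroup.mkOfDetNeZero !![(1 : ℂ), 1; 1, -1] det_cayleyTwo_ne_zero))⁻¹,
            cayley_conj_circleDiagonal_mem_of_eq_over hJ _⟩ : ↥(unitaryGroupOfForm (starRingEnd ℂ) J)) := by
    apply Subtype.ext
    have hv : (![Circle.exp (θ + ψ), Circle.exp (θ - ψ)] : Fin 2 → Circle) = ![Circle.exp θ * Circle.exp ψ, Circle.exp θ * Circle.exp (-ψ)] := by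
      rw [Circle.exp_add, sub_eq_add_neg, Circle.exp_add]
    rw [hv]
  rw [hF, hpt]

end UnitaryGroup

end Literature.NumberTheory.Automorphic

end
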